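import Summits.AnomalousDissipation.AnomalousDissipation.Theorems.SolenoidalFractalHomogenisationLagrangianStepFrameViscousConj

/-!
# K1L_D (stmt-AnomalousDissipation-27980), `stub_Z7_alphaBeta` (α) / memo L15 (T1) item **(C1)**: smooth PIOLA for composed tests —
# `div (G·(Φ ∘ X)) = (div Φ) ∘ X`, hence `IsDivFree (distort G (Φ ∘ X)) ↔ IsDivFree Φ` (helper, `--supports 27980 --as helper`; prover ad-k1loc-p3 g8, TAKES «T1» (C1))

Pure torus calculus (memo L15 §1 (v), §2 (C1)).  Same setting as `…LagrangianStepFrameViscousConj` ((C2), p700154): a smooth displacement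
`u`, `X y = y + proj (u y)`, Jacobian `J(y)_{ac} = ((id + Du(y)) e_c)_a`, a smooth matrix field `G` with `J·G = 1` and divergence-free
columns `Σ_c ∂_c G_{ca} = 0` (Piola).  Then for every smooth vector field `Φ`:
* `divergence_distort_comp_displacement` — `div (distort G (Φ ∘ X)) (y) = (div Φ)(X y)`
  (`div(G·(Φ∘X)) = Σ_a (Σ_c ∂_c G_{ca})·Φ_a∘X + Σ_a Σ_c G_{ca} ∂_c(Φ_a∘X) = 0 + Σ_a (∂_aΦ_a)∘X`, by `sum_mul_partialDeriv_comp_displacement`);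
* `isDivFree_distort_comp_displacement` (⇐) and `isDivFree_distort_comp_displacement_iff` (⇔, `X` surjective);
* the refresh-window frame instances `divergence_distort_frameG`, **`isDivFree_distort_frameG_iff`** (`G = frameG E m (jR+u) (jR)`,
  `X = E.X m (jR+u) (jR)`, surjective by the group law `LevelRegular.X_comp_X`/`X_self`).
So the Eulerian test constraint `IsDivFree (Φ τ′)` is EXACTLY the distorted frame constraint `IsDivFree (distort G (Φ τ′ ∘ X))` of
`Torus.IsWeakTensorPassiveVectorDistortedOn`.  NOT (T1) itself, not `stub_Z7_alphaBeta`, not K1L_D, not AD; rung F-D1.A0.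
-/

set_option linter.dupNamespace false

noncomputable section

namespace Summit.AnomalousDissipation.AnomalousDissipation.Theorems.SolenoidalFractalHomogenisation.LagrangianStep.FrameForm

open Set Function MeasureTheory
open Literature.Analysis Literature.Analysis.FunctionSpaces Literature.Analysis.FunctionSpaces.Torus
open Literature.Analysis.FluidPDE Literature.Analysis.FluidPDE.LatticeShear
open Summit.AnomalousDissipation.AnomalousDissipation.Theorems.SolenoidalFractalHomogenisation.LagrangianCarrier

/-! ## §1 Displacement maps of `𝕋ᵈ` -/

section Displacement

variable {d : Type*} [Fintype d] [DecidableEq d]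

/-- **Smooth Piola for composed fields.**  `u` smooth, `X y = y + proj (u y)`, `G` smooth with `J·G = 1` and `Σ_c ∂_c G_{ca} = 0`; then
`div (distort G (Φ ∘ X)) (y) = (div Φ)(X y)` for every smooth `Φ`. (Evans, PDE §8.1.4.b: divergence-free rows of the cofactor matrix.) [folklore] -/
theorem divergence_distort_comp_displacement {Φ : UnitAddTorus d → EuclideanSpace ℝ d} (hΦ : IsSmooth Φ)
    {u : UnitAddTorus d → EuclideanSpace ℝ d} (hu : IsSmooth u) {G : UnitAddTorus d → Matrix d d ℝ}
    (hG : ∀ c a, IsSmooth (fun y => G y c a))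
    (hJG : ∀ (y : UnitAddTorus d) (a a' : d), ∑ c, ((ContinuousLinearMap.id ℝ (EuclideanSpace ℝ d) + Torus.fderiv u y)
      (EuclideanSpace.single c 1)) a' * G y c a = if a' = a then 1 else 0)
    (hPiola : ∀ (a : d) (y : UnitAddTorus d), ∑ c, partialDeriv c (fun y' => G y' c a) y = 0) (y : UnitAddTorus d) :
    Torus.divergence (FluidPDE.Torus.distort G (fun x => Φ (x + proj (u x)))) y = Torus.divergence Φ (y + proj (u y)) := by
  have hΦa : ∀ a, IsSmooth (fun x => Φ x a) := fun a => hΦ.apply a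
  have hΦSa : ∀ a, IsSmooth (fun y' => Φ (y' + proj (u y')) a) := fun a => isSmooth_comp_displacement (hΦa a) hu
  have hprod : ∀ c a, IsSmooth (fun y' => G y' c a * Φ (y' + proj (u y')) a) := fun c a => ContDiff.mul (hG c a) (hΦSa a)
  unfold Torus.divergence
  have e1 : ∀ c, (fun y' => FluidPDE.Torus.distort G (fun x => Φ (x + proj (u x))) y' c)
      = fun y' => ∑ a, G y' c a * Φ (y' + proj (u y')) a := fun c => by
    funext y'; rw [FluidPDE.Torus.distort_apply]
  simp_rw [e1]
  calc ∑ c, partialDeriv c (fun y' => ∑ a, G y' c a * Φ (y' + proj (u y')) a) y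
      = ∑ c, ∑ a, partialDeriv c (fun y' => G y' c a * Φ (y' + proj (u y')) a) y :=
        Finset.sum_congr rfl fun c _ => partialDeriv_finset_sum _ (fun a _ => (hprod c a).isContDiff (by simp)) c y
    _ = ∑ c, ∑ a, (G y c a * partialDeriv c (fun y' => Φ (y' + proj (u y')) a) y
          + partialDeriv c (fun y' => G y' c a) y * Φ (y + proj (u y)) a) :=
        Finset.sum_congr rfl fun c _ => Finset.sum_congr rfl fun a _ =>
          partialDeriv_mul ((hG c a).isContDiff (by simp)) ((hΦSa a).isContDiff (by simp)) c y
    _ = ∑ a, ∑ c, (G y c a * partialDeriv c (fun y' => Φ (y' + proj (u y')) a) y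
          + partialDeriv c (fun y' => G y' c a) y * Φ (y + proj (u y)) a) := Finset.sum_comm
    _ = ∑ a, (∑ c, G y c a * partialDeriv c (fun y' => Φ (y' + proj (u y')) a) y
          + (∑ c, partialDeriv c (fun y' => G y' c a) y) * Φ (y + proj (u y)) a) :=
        Finset.sum_congr rfl fun a _ => by rw [Finset.sum_add_distrib, Finset.sum_mul]
    _ = ∑ a, partialDeriv a (fun x => Φ x a) (y + proj (u y)) :=
        Finset.sum_congr rfl fun a _ => by
          rw [hPiola a y, zero_mul, add_zero]
          exact sum_mul_partialDeriv_comp_displacement (hΦa a) hu (hJG y) a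

/-- **(⇐)** a divergence-free `Φ` gives a field `Φ ∘ X` satisfying the distorted constraint `div (G·(Φ ∘ X)) = 0`. [folklore] -/
theorem isDivFree_distort_comp_displacement {Φ : UnitAddTorus d → EuclideanSpace ℝ d} (hΦ : IsSmooth Φ)
    {u : UnitAddTorus d → EuclideanSpace ℝ d} (hu : IsSmooth u) {G : UnitAddTorus d → Matrix d d ℝ}
    (hG : ∀ c a, IsSmooth (fun y => G y c a))
    (hJG : ∀ (y : UnitAddTorus d) (a a' : d), ∑ c, ((ContinuousLinearMap.id ℝ (EuclideanSpace ℝ d) + Torus.fderiv u y)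
      (EuclideanSpace.single c 1)) a' * G y c a = if a' = a then 1 else 0)
    (hPiola : ∀ (a : d) (y : UnitAddTorus d), ∑ c, partialDeriv c (fun y' => G y' c a) y = 0) (hΦ0 : Torus.IsDivFree Φ) :
    Torus.IsDivFree (FluidPDE.Torus.distort G (fun x => Φ (x + proj (u x)))) := fun y => by
  rw [divergence_distort_comp_displacement hΦ hu hG hJG hPiola y]
  exact hΦ0 _

/-- **(⇔)** when `X` is onto (e.g. a flow map): `IsDivFree (distort G (Φ ∘ X)) ↔ IsDivFree Φ`. [folklore] -/
theorem isDivFree_distort_comp_displacement_iff {Φ : UnitAddTorus d → EuclideanSpace ℝ d} (hΦ : IsSmooth Φ)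
    {u : UnitAddTorus d → EuclideanSpace ℝ d} (hu : IsSmooth u) {G : UnitAddTorus d → Matrix d d ℝ}
    (hG : ∀ c a, IsSmooth (fun y => G y c a))
    (hJG : ∀ (y : UnitAddTorus d) (a a' : d), ∑ c, ((ContinuousLinearMap.id ℝ (EuclideanSpace ℝ d) + Torus.fderiv u y)
      (EuclideanSpace.single c 1)) a' * G y c a = if a' = a then 1 else 0)
    (hPiola : ∀ (a : d) (y : UnitAddTorus d), ∑ c, partialDeriv c (fun y' => G y' c a) y = 0)
    (hX : Surjective (fun x : UnitAddTorus d => x + proj (u x))) :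
    Torus.IsDivFree (FluidPDE.Torus.distort G (fun x => Φ (x + proj (u x)))) ↔ Torus.IsDivFree Φ := by
  refine ⟨fun h x => ?_, isDivFree_distort_comp_displacement hΦ hu hG hJG hPiola⟩
  obtain ⟨y, rfl⟩ := hX x
  rw [← divergence_distort_comp_displacement hΦ hu hG hJG hPiola y]
  exact h y

end Displacement

/-! ## §2 The Lagrangian frame of a level-regular carrier on a refresh window -/

section Frame

variable {k : ℕ}

/-- `J·G = 1` for the frame on a refresh window, in the coordinates of `partialDeriv_comp_displacement`. [folklore] -/
theorem sum_flowJac_mul_frameG (E : LagrangianLatticeCarrier k) (hR : E.LevelRegular) {m : ℕ} (hF : E.IsFlow m) (j : ℤ) {T : ℝ}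
    (hT : T < E.refresh (m + 1)) {u : ℝ} (hu : u ∈ Icc 0 T) (y : UnitAddTorus (Fin 3)) (a a' : Fin 3) :
    ∑ c, ((ContinuousLinearMap.id ℝ (EuclideanSpace ℝ (Fin 3))
      + Torus.fderiv (E.disp m ((j : ℝ) * E.refresh (m + 1) + u) ((j : ℝ) * E.refresh (m + 1))) y) (EuclideanSpace.single c 1)) a'
      * frameG E m ((j : ℝ) * E.refresh (m + 1) + u) ((j : ℝ) * E.refresh (m + 1)) y c a = if a' = a then 1 else 0 := by
  have hdet : IsUnit (frameJac E m ((j : ℝ) * E.refresh (m + 1) + u) ((j : ℝ) * E.refresh (m + 1)) y).det := by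
    rw [det_frameJac_eq_one E hR hF j hT hu y]; exact isUnit_one
  have h := Matrix.mul_nonsing_inv _ hdet
  have h2 := congrFun (congrFun h a') a
  rw [Matrix.mul_apply, Matrix.one_apply] at h2
  have hfd : E.flowDeriv m ((j : ℝ) * E.refresh (m + 1) + u) ((j : ℝ) * E.refresh (m + 1)) y
      = ContinuousLinearMap.id ℝ (EuclideanSpace ℝ (Fin 3))
        + Torus.fderiv (E.disp m ((j : ℝ) * E.refresh (m + 1) + u) ((j : ℝ) * E.refresh (m + 1))) y := by
    rw [LagrangianLatticeCarrier.flowDeriv, fderiv_lift, proj_repr]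
  rw [← hfd]
  exact h2

/-- Piola for the frame on a refresh window, in coordinates: `Σ_c ∂_c (frameG)_{ca} = 0`. [folklore] -/
theorem sum_partialDeriv_frameG_col (E : LagrangianLatticeCarrier k) (hR : E.LevelRegular) {m : ℕ} (hF : E.IsFlow m) (j : ℤ) {T : ℝ}
    (hT : T < E.refresh (m + 1)) {u : ℝ} (hu : u ∈ Icc 0 T) (a : Fin 3) (y : UnitAddTorus (Fin 3)) :
    ∑ c, partialDeriv c (fun y' => frameG E m ((j : ℝ) * E.refresh (m + 1) + u) ((j : ℝ) * E.refresh (m + 1)) y' c a) y = 0 := by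
  have h := isDivFree_frameG_col E hR hF j hT hu a y
  simpa only [Torus.divergence, PiLp.toLp_apply] using h

/-- The flow map of a level-regular carrier is onto (group law). [folklore] -/
theorem surjective_X (E : LagrangianLatticeCarrier k) (hR : E.LevelRegular) (m : ℕ) (t s : ℝ) : Surjective (E.X m t s) := fun x =>
  ⟨E.X m s t x, by
    have h := congrFun (hR.X_comp_X m t s t) x
    rw [Function.comp_apply, hR.X_self m t] at h
    exact h⟩

/-- **Smooth Piola in the exact-flow frame**: `div (distort (frameG …) (Φ ∘ X)) (y) = (div Φ)(X y)` on a refresh window. [folklore] -/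
theorem divergence_distort_frameG (E : LagrangianLatticeCarrier k) (hR : E.LevelRegular) {m : ℕ} (hF : E.IsFlow m) (j : ℤ) {T : ℝ}
    (hT : T < E.refresh (m + 1)) {u : ℝ} (hu : u ∈ Icc 0 T) {Φ : UnitAddTorus (Fin 3) → EuclideanSpace ℝ (Fin 3)} (hΦ : IsSmooth Φ)
    (y : UnitAddTorus (Fin 3)) :
    Torus.divergence (FluidPDE.Torus.distort (frameG E m ((j : ℝ) * E.refresh (m + 1) + u) ((j : ℝ) * E.refresh (m + 1)))
        (fun x => Φ (E.X m ((j : ℝ) * E.refresh (m + 1) + u) ((j : ℝ) * E.refresh (m + 1)) x))) y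
      = Torus.divergence Φ (E.X m ((j : ℝ) * E.refresh (m + 1) + u) ((j : ℝ) * E.refresh (m + 1)) y) :=
  divergence_distort_comp_displacement hΦ (hR.isSmooth_disp m _ _) (fun c a => isSmooth_frameG_entry E hR hF j hT hu c a)
    (sum_flowJac_mul_frameG E hR hF j hT hu) (sum_partialDeriv_frameG_col E hR hF j hT hu) y

/-- **(C1) The Eulerian test constraint is the distorted frame constraint**: on a refresh window,
`IsDivFree (distort (frameG …) (Φ ∘ X)) ↔ IsDivFree Φ` for every smooth `Φ`. [folklore] -/
theorem isDivFree_distort_frameG_iff (E : LagrangianLatticeCarrier k) (hR : E.LevelRegular) {m : ℕ} (hF : E.IsFlow m) (j : ℤ) {T : ℝ}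
    (hT : T < E.refresh (m + 1)) {u : ℝ} (hu : u ∈ Icc 0 T) {Φ : UnitAddTorus (Fin 3) → EuclideanSpace ℝ (Fin 3)} (hΦ : IsSmooth Φ) :
    Torus.IsDivFree (FluidPDE.Torus.distort (frameG E m ((j : ℝ) * E.refresh (m + 1) + u) ((j : ℝ) * E.refresh (m + 1)))
        (fun x => Φ (E.X m ((j : ℝ) * E.refresh (m + 1) + u) ((j : ℝ) * E.refresh (m + 1)) x)))
      ↔ Torus.IsDivFree Φ :=
  isDivFree_distort_comp_displacement_iff hΦ (hR.isSmooth_disp m _ _) (fun c a => isSmooth_frameG_entry E hR hF j hT hu c a)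
    (sum_flowJac_mul_frameG E hR hF j hT hu) (sum_partialDeriv_frameG_col E hR hF j hT hu) (surjective_X E hR m _ _)

end Frame

end Summit.AnomalousDissipation.AnomalousDissipation.Theorems.SolenoidalFractalHomogenisation.LagrangianStep.FrameForm

end
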